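import Mathlib
import Literature.Probability.RandomPlanarGeometry.FreelyJointedSAW
import Literature.Probability.RandomPlanarGeometry.PolylineUniform
import Literature.Probability.RandomPlanarGeometry.ChordalReversibility
import HarnessLib

/-!
# Reversibility of the critical freely-jointed chain

Topic `Literature/Probability/RandomPlanarGeometry`; theorems only, continuing
`FreelyJointedSAW.lean` (definition request `FreelyJointedSAW.law`, route `SAWIsotropicAnchor`).

* `FreelyJointedSAW.law_reverse` — **exact reversibility at every step length**:
  `law ℓ Ω y x = reverse_* law ℓ Ω x y` (`CurveClass.reverse`), the off-lattice twin of the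
  reversal symmetry of the lattice SAW two-point measure (Lawler–Schramm–Werner 2004, §3.1:
  `μ_SAW` is invariant under `ω ↦` the reversed walk; Madras–Slade 1993, §1.1).

Proof: on configuration space `ℂ × ℝ^N` the map
`G(z, θ) = (z + ℓ S_N(θ), (h(θ_{N-1-j}))_j)`, where `S_N(θ) = ∑ e^{iθ_j}` is the endpoint
displacement and `h` is the HALF-TURN `θ ↦ θ ± π` within each cell `[2πk, 2πk + 2π)` (an
involution of `ℝ` preserving Lebesgue measure and the angle box `[0, 2π)`), preserves the full
Lebesgue measure `Leb_ℂ ⊗ Leb_{ℝ^N}` (a shear composed with a coordinate permutation and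
coordinatewise half-turns: `map_volume_configReversal`), intertwines the configuration-to-curve
map with time reversal (`chainCurve ℓ N (G p) = (chainCurve ℓ N p).reverse`, by
`Polyline.reverse_mk_polyline_ofFn` and the reindexing `S_N - ∑_{j<k} e^{iθ_{N-1-j}} = S_{N-k}`),
and pulls the admissible configurations from `B(y,ℓ)` to `B(x,ℓ)` back to those from `B(x,ℓ)`
to `B(y,ℓ)` (`preimage_configReversal`). Writing each term of `weight` as the image of FULL
Lebesgue measure restricted to the admissible configurations (`weightTerm_eq`), the change of
variables needs no injectivity of `G` (`Measure.restrict_map`). Elementary; tagged [folklore]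
except the headline identity.

## References

* G. F. Lawler, O. Schramm, W. Werner, *On the scaling limit of planar self-avoiding walk* (2004),
  §3.1. [LawlerSchrammWerner2004SAW]
-/

noncomputable section

open MeasureTheory Set Filter Function
open scoped ENNReal NNReal unitInterval Topology Real

namespace Literature.Probability.RandomPlanarGeometry

namespace FreelyJointedSAW

/-! ### The half-turn of an angle within its cell -/

/-- The half-open half-cells `{fract (θ/2π) < 1/2} = ⋃ₖ [2πk, 2πk + π)`: adding `π` moves a
point of a lower half-cell to the upper half of the same cell and a point of an upper half-cell
to the lower half of the next cell. [folklore] -/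
theorem fract_add_pi_lt_half_iff (θ : ℝ) :
    Int.fract ((θ + π) / (2 * π)) < 1 / 2 ↔ ¬ Int.fract (θ / (2 * π)) < 1 / 2 := by
  have h2π : (0 : ℝ) < 2 * π := Real.two_pi_pos
  have hx : (θ + π) / (2 * π) = θ / (2 * π) + 1 / 2 := by
    field_simp
  rw [hx]
  set x := θ / (2 * π) with hx_def
  have hf0 := Int.fract_nonneg x
  have hf1 := Int.fract_lt_one x
  by_cases h : Int.fract x < 1 / 2
  · have : Int.fract (x + 1 / 2) = Int.fract x + 1 / 2 := by
      rw [Int.fract_eq_iff]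
      refine ⟨by linarith, by linarith, ⌊x⌋, ?_⟩
      rw [show x + 1 / 2 - (Int.fract x + 1 / 2) = x - Int.fract x by ring, Int.self_sub_fract]
    rw [this]
    constructor
    · intro h'
      linarith
    · intro h'
      exact absurd h h'
  · have : Int.fract (x + 1 / 2) = Int.fract x - 1 / 2 := by
      rw [Int.fract_eq_iff]
      refine ⟨by linarith, by linarith, ⌊x⌋ + 1, ?_⟩
      rw [show x + 1 / 2 - (Int.fract x - 1 / 2) = x - Int.fract x + 1 by ring, Int.self_sub_fract]
      push_cast
      ring
    rw [this]
    constructor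
    · intro _
      exact h
    · intro _
      linarith

/-- The half-turn within cells is Borel measurable. [folklore] -/
theorem measurable_halfTurn :
    Measurable fun θ : ℝ => if Int.fract (θ / (2 * π)) < 1 / 2 then θ + π else θ - π := by
  refine Measurable.ite ?_ (measurable_id.add_const _) (measurable_id.sub_const _)
  exact measurableSet_lt (measurable_fract.comp (measurable_id.div_const _)) measurable_const

/-- **The half-turn within cells preserves Lebesgue measure**: it translates the lower
half-cells by `+π` onto the upper half-cells and the upper half-cells by `-π` onto the lower
half-cells. [folklore] -/
theorem map_volume_halfTurn :
    (volume : Measure ℝ).map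
        (fun θ : ℝ => if Int.fract (θ / (2 * π)) < 1 / 2 then θ + π else θ - π) = volume := by
  set C : Set ℝ := {θ | Int.fract (θ / (2 * π)) < 1 / 2} with hC_def
  have hC : MeasurableSet C :=
    measurableSet_lt (measurable_fract.comp (measurable_id.div_const _)) measurable_const
  set g : ℝ → ℝ := fun θ => if Int.fract (θ / (2 * π)) < 1 / 2 then θ + π else θ - π with hg_def
  have hg : Measurable g := measurable_halfTurn
  ext B hB
  rw [Measure.map_apply hg hB]
  -- split the preimage along the lower half-cells `C` and their complement
  have h1 : g ⁻¹' B ∩ C = (fun θ => θ + π) ⁻¹' (B ∩ Cᶜ) := by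
    ext θ
    simp only [mem_inter_iff, mem_preimage, mem_compl_iff, hg_def, hC_def, mem_setOf_eq]
    constructor
    · rintro ⟨hθB, hθC⟩
      rw [if_pos hθC] at hθB
      exact ⟨hθB, fun h => (fract_add_pi_lt_half_iff θ).1 h hθC⟩
    · rintro ⟨hθB, hθC⟩
      have hθ : Int.fract (θ / (2 * π)) < 1 / 2 := by
        by_contra h
        exact hθC ((fract_add_pi_lt_half_iff θ).2 h)
      rw [if_pos hθ]
      exact ⟨hθB, hθ⟩
  have h2 : g ⁻¹' B ∩ Cᶜ = (fun θ => θ + (-π)) ⁻¹' (B ∩ C) := by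
    ext θ
    simp only [mem_inter_iff, mem_preimage, mem_compl_iff, hg_def, hC_def, mem_setOf_eq,
      ← sub_eq_add_neg]
    have key := fract_add_pi_lt_half_iff (θ - π)
    rw [sub_add_cancel] at key
    constructor
    · rintro ⟨hθB, hθC⟩
      rw [if_neg hθC] at hθB
      refine ⟨hθB, ?_⟩
      by_contra h
      exact hθC (key.2 h)
    · rintro ⟨hθB, hθC⟩
      have hθ : ¬ Int.fract (θ / (2 * π)) < 1 / 2 := fun h => key.1 h hθC
      rw [if_neg hθ]
      exact ⟨hθB, hθ⟩
  rw [← measure_inter_add_sdiff (g ⁻¹' B) hC, Set.sdiff_eq, h1, h2, measure_preimage_add_right,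
    measure_preimage_add_right, add_comm, ← Set.sdiff_eq, measure_inter_add_sdiff B hC]

/-- The half-turn reverses the direction: `e^{i h(θ)} = -e^{iθ}`. [folklore] -/
theorem exp_halfTurn (θ : ℝ) :
    Complex.exp (Complex.I *
        ((if Int.fract (θ / (2 * π)) < 1 / 2 then θ + π else θ - π : ℝ) : ℂ)) =
      -Complex.exp (Complex.I * θ) := by
  split_ifs
  · push_cast
    rw [mul_add, Complex.exp_add, mul_comm Complex.I (π : ℂ), Complex.exp_pi_mul_I]
    ring
  · push_cast
    rw [mul_sub, Complex.exp_sub, mul_comm Complex.I (π : ℂ), Complex.exp_pi_mul_I]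
    ring

/-- The half-turn maps the angle box `[0, 2π)` onto itself (and nothing else into it).
[folklore] -/
theorem halfTurn_mem_Ico_iff (θ : ℝ) :
    (if Int.fract (θ / (2 * π)) < 1 / 2 then θ + π else θ - π) ∈ Set.Ico 0 (2 * π) ↔
      θ ∈ Set.Ico 0 (2 * π) := by
  have hπ : 0 < π := Real.pi_pos
  have h2π : (0 : ℝ) < 2 * π := Real.two_pi_pos
  constructor
  · intro h
    split_ifs at h with hc
    · obtain ⟨h0, h1⟩ := h
      refine ⟨le_of_not_gt fun hneg => ?_, by linarith⟩
      -- `θ ∈ [-π, 0)`: then `fract (θ/2π) = θ/2π + 1 ≥ 1/2`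
      have hy0 : -(1 / 2 : ℝ) ≤ θ / (2 * π) := by
        rw [le_div_iff₀ h2π]
        linarith
      have hy1 : θ / (2 * π) < 0 := div_neg_of_neg_of_pos hneg h2π
      have hf : Int.fract (θ / (2 * π)) = θ / (2 * π) + 1 := by
        rw [Int.fract_eq_iff]
        refine ⟨by linarith, by linarith, -1, ?_⟩
        push_cast
        ring
      rw [hf] at hc
      linarith
    · obtain ⟨h0, h1⟩ := h
      refine ⟨by linarith, lt_of_not_ge fun hge => ?_⟩
      -- `θ ∈ [2π, 3π)`: then `fract (θ/2π) = θ/2π - 1 < 1/2`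
      have hy0 : (1 : ℝ) ≤ θ / (2 * π) := by rwa [le_div_iff₀ h2π, one_mul]
      have hy1 : θ / (2 * π) < 3 / 2 := by
        rw [div_lt_iff₀ h2π]
        linarith
      have hf : Int.fract (θ / (2 * π)) = θ / (2 * π) - 1 := by
        rw [Int.fract_eq_iff]
        refine ⟨by linarith, by linarith, 1, ?_⟩
        push_cast
        ring
      rw [hf] at hc
      exact hc (by linarith)
  · rintro ⟨h0, h1⟩
    have hf : Int.fract (θ / (2 * π)) = θ / (2 * π) :=
      Int.fract_eq_self.2 ⟨div_nonneg h0 h2π.le, (div_lt_one h2π).2 h1⟩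
    rw [hf]
    split_ifs with hc
    · rw [div_lt_iff₀ h2π] at hc
      exact ⟨by linarith, by linarith⟩
    · rw [div_lt_iff₀ h2π, not_lt] at hc
      exact ⟨by linarith, by linarith⟩

/-! ### Symmetries of Lebesgue measure on configuration space -/

/-- Coordinatewise half-turns preserve Lebesgue measure on `ℝ^N`. [folklore] -/
theorem map_volume_pi_halfTurn (N : ℕ) :
    (volume : Measure (Fin N → ℝ)).map (fun θ j =>
        if Int.fract (θ j / (2 * π)) < 1 / 2 then θ j + π else θ j - π) = volume :=
  (volume_preserving_pi (fun _ : Fin N =>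
    (⟨measurable_halfTurn, map_volume_halfTurn⟩ :
      MeasurePreserving (fun θ : ℝ => if Int.fract (θ / (2 * π)) < 1 / 2 then θ + π else θ - π)
        volume volume))).map_eq

/-- Reversing the order of the coordinates preserves Lebesgue measure on `ℝ^N`. [folklore] -/
theorem map_volume_comp_rev (N : ℕ) :
    (volume : Measure (Fin N → ℝ)).map (fun θ j => θ (Fin.rev j)) = volume := by
  have hm : Measurable fun θ : Fin N → ℝ => fun j => θ (Fin.rev j) :=
    measurable_pi_lambda _ fun j => measurable_pi_apply _
  rw [volume_pi]
  refine (Measure.pi_eq fun s hs => ?_).symm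
  rw [Measure.map_apply hm (MeasurableSet.univ_pi hs)]
  have hpre : (fun θ : Fin N → ℝ => fun j => θ (Fin.rev j)) ⁻¹' (Set.univ.pi s) =
      Set.univ.pi fun j => s (Fin.rev j) := by
    ext θ
    simp only [mem_preimage, mem_univ_pi]
    constructor
    · intro h j
      simpa using h (Fin.rev j)
    · intro h j
      simpa using h (Fin.rev j)
  rw [hpre, Measure.pi_pi]
  exact Fintype.prod_equiv Fin.revPerm _ _ fun j => rfl

/-- **The endpoint shear preserves Lebesgue measure**: `(z, θ) ↦ (z + ℓ S_N(θ), θ)` preserves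
`Leb_ℂ ⊗ Leb_{ℝ^N}` (a translation of `z` for each fixed `θ`). [folklore] -/
theorem measurePreserving_shear (ℓ : ℝ) (N : ℕ) :
    MeasurePreserving (fun p : ℂ × (Fin N → ℝ) => (p.1 + (ℓ : ℂ) * steps N p.2 (Fin.last N), p.2))
      ((volume : Measure ℂ).prod (volume : Measure (Fin N → ℝ)))
      ((volume : Measure ℂ).prod (volume : Measure (Fin N → ℝ))) := by
  -- conjugate the skew product `(θ, z) ↦ (θ, z + ℓ S_N(θ))` by the swap
  have hskew : MeasurePreserving
      (fun q : (Fin N → ℝ) × ℂ => (q.1, q.2 + (ℓ : ℂ) * steps N q.1 (Fin.last N)))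
      ((volume : Measure (Fin N → ℝ)).prod (volume : Measure ℂ))
      ((volume : Measure (Fin N → ℝ)).prod (volume : Measure ℂ)) := by
    refine MeasurePreserving.skew_product (MeasurePreserving.id _)
      (g := fun θ z => z + (ℓ : ℂ) * steps N θ (Fin.last N)) ?_
      (Filter.Eventually.of_forall fun θ => map_add_right_eq_self _ _)
    exact measurable_snd.add (measurable_const.mul
      ((continuous_steps N (Fin.last N)).measurable.comp measurable_fst))
  have h := (Measure.measurePreserving_swap (μ := (volume : Measure (Fin N → ℝ)))
    (ν := (volume : Measure ℂ))).comp (hskew.comp (Measure.measurePreserving_swap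
      (μ := (volume : Measure ℂ)) (ν := (volume : Measure (Fin N → ℝ)))))
  convert h using 1
  funext p
  rfl

/-- **The configuration reversal preserves Lebesgue measure on `ℂ × ℝ^N`**: the endpoint shear
followed by reversing the order of the angles and half-turning each of them. [folklore] -/
theorem map_volume_configReversal (ℓ : ℝ) (N : ℕ) :
    ((volume : Measure ℂ).prod (volume : Measure (Fin N → ℝ))).map
        (fun p : ℂ × (Fin N → ℝ) => (p.1 + (ℓ : ℂ) * steps N p.2 (Fin.last N),
          fun j => if Int.fract (p.2 (Fin.rev j) / (2 * π)) < 1 / 2 then p.2 (Fin.rev j) + π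
            else p.2 (Fin.rev j) - π)) =
      (volume : Measure ℂ).prod (volume : Measure (Fin N → ℝ)) := by
  -- the angle part `T = (coordinatewise half-turn) ∘ (reverse the coordinates)`
  have hh : Measurable fun θ : Fin N → ℝ => fun j =>
      if Int.fract (θ j / (2 * π)) < 1 / 2 then θ j + π else θ j - π :=
    measurable_pi_lambda _ fun j => measurable_halfTurn.comp (measurable_pi_apply j)
  have hr : Measurable fun θ : Fin N → ℝ => fun j => θ (Fin.rev j) :=
    measurable_pi_lambda _ fun j => measurable_pi_apply _
  have hT : Measurable fun θ : Fin N → ℝ => fun j =>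
      if Int.fract (θ (Fin.rev j) / (2 * π)) < 1 / 2 then θ (Fin.rev j) + π
        else θ (Fin.rev j) - π := hh.comp hr
  have hTvol : (volume : Measure (Fin N → ℝ)).map (fun θ : Fin N → ℝ => fun j =>
      if Int.fract (θ (Fin.rev j) / (2 * π)) < 1 / 2 then θ (Fin.rev j) + π
        else θ (Fin.rev j) - π) = volume := by
    rw [show (fun θ : Fin N → ℝ => fun j =>
        if Int.fract (θ (Fin.rev j) / (2 * π)) < 1 / 2 then θ (Fin.rev j) + π
          else θ (Fin.rev j) - π) =
        (fun θ : Fin N → ℝ => fun j => if Int.fract (θ j / (2 * π)) < 1 / 2 then θ j + π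
          else θ j - π) ∘ (fun θ : Fin N → ℝ => fun j => θ (Fin.rev j)) from rfl,
      ← Measure.map_map hh hr, map_volume_comp_rev, map_volume_pi_halfTurn]
  -- the whole map is `(id × T) ∘ shear`
  have hshear := measurePreserving_shear ℓ N
  rw [show (fun p : ℂ × (Fin N → ℝ) => (p.1 + (ℓ : ℂ) * steps N p.2 (Fin.last N),
        fun j => if Int.fract (p.2 (Fin.rev j) / (2 * π)) < 1 / 2 then p.2 (Fin.rev j) + π
          else p.2 (Fin.rev j) - π)) =
      Prod.map id (fun θ : Fin N → ℝ => fun j =>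
        if Int.fract (θ (Fin.rev j) / (2 * π)) < 1 / 2 then θ (Fin.rev j) + π
          else θ (Fin.rev j) - π) ∘
        (fun p : ℂ × (Fin N → ℝ) => (p.1 + (ℓ : ℂ) * steps N p.2 (Fin.last N), p.2)) from rfl,
    ← Measure.map_map (measurable_id.prodMap hT) hshear.measurable, hshear.map_eq,
    ← Measure.map_prod_map _ _ measurable_id hT, Measure.map_id, hTvol]

/-! ### The reversed chain -/

/-- The chain starts at the origin of the unit chain: `S_0 = 0`. [folklore] -/
@[simp] theorem steps_zero (N : ℕ) (θ : Fin N → ℝ) : steps N θ 0 = 0 := by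
  unfold steps
  simp

/-- Reindexing: the endpoint displacement is the displacement to the `(N-k)`-th vertex plus
the last `k` steps taken backwards. [folklore] -/
theorem steps_last_eq {N : ℕ} (θ : Fin N → ℝ) (k : Fin (N + 1)) :
    steps N θ (Fin.last N) = steps N θ (Fin.rev k) +
      ∑ j : Fin N, (if (j : ℕ) < (k : ℕ) then Complex.exp (Complex.I * θ (Fin.rev j)) else 0) := by
  unfold steps
  rw [← Equiv.sum_comp Fin.revPerm (fun j : Fin N =>
      if (j : ℕ) < (k : ℕ) then Complex.exp (Complex.I * θ (Fin.rev j)) else 0),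
    ← Finset.sum_add_distrib]
  refine Finset.sum_congr rfl fun m _ => ?_
  simp only [Fin.revPerm_apply, Fin.rev_rev, Fin.val_last, Fin.val_rev]
  have hm := m.2
  have hk := k.2
  split_ifs <;> first | (simp; done) | (exfalso; omega)

/-- The unit chain of the reversed, half-turned angles runs the original steps backwards.
[folklore] -/
theorem steps_halfTurn_rev {N : ℕ} (θ : Fin N → ℝ) (k : Fin (N + 1)) :
    steps N (fun j => if Int.fract (θ (Fin.rev j) / (2 * π)) < 1 / 2 then θ (Fin.rev j) + π
        else θ (Fin.rev j) - π) k =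
      -∑ j : Fin N, (if (j : ℕ) < (k : ℕ) then Complex.exp (Complex.I * θ (Fin.rev j)) else 0) := by
  unfold steps
  rw [← Finset.sum_neg_distrib]
  refine Finset.sum_congr rfl fun j _ => ?_
  split_ifs
  · exact exp_halfTurn (θ (Fin.rev j))
  · rw [neg_zero]

/-- **The configuration reversal reverses the chain**: the chain of `G(z, θ)` is the time
reversal of the chain of `(z, θ)`. [folklore] -/
theorem chainCurve_configReversal (ℓ : ℝ) (N : ℕ) (p : ℂ × (Fin N → ℝ)) :
    chainCurve ℓ N (p.1 + (ℓ : ℂ) * steps N p.2 (Fin.last N),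
        fun j => if Int.fract (p.2 (Fin.rev j) / (2 * π)) < 1 / 2 then p.2 (Fin.rev j) + π
          else p.2 (Fin.rev j) - π) =
      (chainCurve ℓ N p).reverse := by
  have hv : (fun k : Fin (N + 1) => p.1 + (ℓ : ℂ) * steps N p.2 (Fin.last N) +
      (ℓ : ℂ) * steps N (fun j => if Int.fract (p.2 (Fin.rev j) / (2 * π)) < 1 / 2
        then p.2 (Fin.rev j) + π else p.2 (Fin.rev j) - π) k) =
      fun k => p.1 + (ℓ : ℂ) * steps N p.2 (Fin.rev k) := by
    funext k
    rw [steps_halfTurn_rev, steps_last_eq p.2 k]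
    ring
  unfold chainCurve curveOf
  rw [Polyline.reverse_mk_polyline_ofFn]
  change CurveClass.mk ⟨LatticeModels.polyline (List.ofFn fun k : Fin (N + 1) =>
      p.1 + (ℓ : ℂ) * steps N p.2 (Fin.last N) +
        (ℓ : ℂ) * steps N (fun j => if Int.fract (p.2 (Fin.rev j) / (2 * π)) < 1 / 2
          then p.2 (Fin.rev j) + π else p.2 (Fin.rev j) - π) k)⟩ = _
  rw [hv]

/-- The chain starts at the starting point of the configuration. [folklore] -/
theorem source_chainCurve (ℓ : ℝ) (N : ℕ) (p : ℂ × (Fin N → ℝ)) :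
    (chainCurve ℓ N p).source = p.1 := by
  unfold chainCurve curveOf
  rw [CurveClass.source_mk, Curve.source_def]
  change LatticeModels.polyline (List.ofFn fun k => p.1 + (ℓ : ℂ) * steps N p.2 k) 0 = p.1
  rw [List.ofFn_succ, LatticeModels.polyline_apply_zero, steps_zero, mul_zero, add_zero]

/-- A polyline through `v 0, …, v N` ends at `v N`. [folklore] -/
theorem polyline_ofFn_apply_one : ∀ {N : ℕ} (v : Fin (N + 1) → ℂ),
    LatticeModels.polyline (List.ofFn v) 1 = v (Fin.last N)
  | 0, v => by
      rw [List.ofFn_succ, List.ofFn_zero, LatticeModels.polyline_apply_one]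
      rfl
  | N + 1, v => by
      rw [List.ofFn_succ, LatticeModels.polyline_apply_one, List.getLast_cons (by simp),
        List.getLast_ofFn_succ, Fin.succ_last]

/-- The chain ends at `z + ℓ S_N(θ)`. [folklore] -/
theorem target_chainCurve (ℓ : ℝ) (N : ℕ) (p : ℂ × (Fin N → ℝ)) :
    (chainCurve ℓ N p).target = p.1 + (ℓ : ℂ) * steps N p.2 (Fin.last N) := by
  unfold chainCurve curveOf
  rw [CurveClass.target_mk, Curve.target_def]
  exact polyline_ofFn_apply_one _

/-! ### The admissible configurations and the reversal of the law -/

/-- **The configuration reversal exchanges the roles of the endpoints**: a configuration is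
admissible from `B(y,ℓ)` to `B(x,ℓ)` after reversal iff it is admissible from `B(x,ℓ)` to
`B(y,ℓ)` (simplicity and trace are reversal invariant; source and target are exchanged; the
angle box is preserved by the half-turns and the reindexing). [folklore] -/
theorem preimage_configReversal (ℓ : ℝ) (Ω : Set ℂ) (x y : ℂ) (N : ℕ) :
    (fun p : ℂ × (Fin N → ℝ) => (p.1 + (ℓ : ℂ) * steps N p.2 (Fin.last N),
        fun j => if Int.fract (p.2 (Fin.rev j) / (2 * π)) < 1 / 2 then p.2 (Fin.rev j) + π
          else p.2 (Fin.rev j) - π)) ⁻¹'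
      ((Metric.ball y ℓ ×ˢ (Set.univ.pi fun _ : Fin N => Set.Ico (0 : ℝ) (2 * π))) ∩
        chainCurve ℓ N ⁻¹' admissible ℓ Ω x) =
      (Metric.ball x ℓ ×ˢ (Set.univ.pi fun _ : Fin N => Set.Ico (0 : ℝ) (2 * π))) ∩
        chainCurve ℓ N ⁻¹' admissible ℓ Ω y := by
  ext p
  simp only [mem_preimage, mem_inter_iff, mem_prod, mem_univ_pi, admissible, mem_setOf_eq,
    chainCurve_configReversal, CurveClass.reverse_mem_simple_iff, CurveClass.range_reverse,
    CurveClass.target_reverse, source_chainCurve, halfTurn_mem_Ico_iff]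
  rw [← target_chainCurve ℓ N p]
  have hbox : (∀ j : Fin N, p.2 (Fin.rev j) ∈ Set.Ico (0 : ℝ) (2 * π)) ↔
      ∀ j : Fin N, p.2 j ∈ Set.Ico (0 : ℝ) (2 * π) :=
    ⟨fun h j => by simpa using h (Fin.rev j), fun h j => h _⟩
  rw [hbox]
  tauto

/-- The admissible configurations from `B(x,ℓ)` to `B(y,ℓ)` form a Borel set. [folklore] -/
theorem measurableSet_admissibleConfigs (ℓ : ℝ) (Ω : Set ℂ) (x y : ℂ) (N : ℕ) :
    MeasurableSet ((Metric.ball x ℓ ×ˢ (Set.univ.pi fun _ : Fin N => Set.Ico (0 : ℝ) (2 * π))) ∩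
      chainCurve ℓ N ⁻¹' admissible ℓ Ω y) :=
  (measurableSet_ball.prod (MeasurableSet.univ_pi fun _ => measurableSet_Ico)).inter
    (measurableSet_preimage_admissible ℓ Ω y N)

/-- Each term of `weight` is the image of FULL Lebesgue measure on `ℂ × ℝ^N` restricted to the
admissible configurations. [folklore] -/
theorem weightTerm_eq (ℓ : ℝ) (Ω : Set ℂ) (x y : ℂ) (N : ℕ) :
    ((configMeasure ℓ x N).restrict (chainCurve ℓ N ⁻¹' admissible ℓ Ω y)).map (chainCurve ℓ N) =
      (((volume : Measure ℂ).prod (volume : Measure (Fin N → ℝ))).restrict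
        ((Metric.ball x ℓ ×ˢ (Set.univ.pi fun _ : Fin N => Set.Ico (0 : ℝ) (2 * π))) ∩
          chainCurve ℓ N ⁻¹' admissible ℓ Ω y)).map (chainCurve ℓ N) := by
  rw [configMeasure, Measure.prod_restrict,
    Measure.restrict_restrict (measurableSet_preimage_admissible ℓ Ω y N), Set.inter_comm]

/-- **Each term of the unnormalised measure is reversed by time reversal.** [folklore] -/
theorem weightTerm_reverse (ℓ : ℝ) (Ω : Set ℂ) (x y : ℂ) (N : ℕ) :
    (((configMeasure ℓ x N).restrict (chainCurve ℓ N ⁻¹' admissible ℓ Ω y)).map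
        (chainCurve ℓ N)).map CurveClass.reverse =
      ((configMeasure ℓ y N).restrict (chainCurve ℓ N ⁻¹' admissible ℓ Ω x)).map
        (chainCurve ℓ N) := by
  have hV : Measurable (chainCurve ℓ N) := measurable_chainCurve ℓ N
  have hG : Measurable (fun p : ℂ × (Fin N → ℝ) => (p.1 + (ℓ : ℂ) * steps N p.2 (Fin.last N),
      fun j => if Int.fract (p.2 (Fin.rev j) / (2 * π)) < 1 / 2 then p.2 (Fin.rev j) + π
        else p.2 (Fin.rev j) - π)) := by
    refine Measurable.prodMk (measurable_fst.add (measurable_const.mul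
      ((continuous_steps N (Fin.last N)).measurable.comp measurable_snd))) ?_
    exact measurable_pi_lambda _ fun j => measurable_halfTurn.comp
      ((measurable_pi_apply (Fin.rev j)).comp measurable_snd)
  rw [weightTerm_eq, weightTerm_eq, Measure.map_map CurveClass.measurable_reverse hV,
    show CurveClass.reverse ∘ chainCurve ℓ N = chainCurve ℓ N ∘
        (fun p : ℂ × (Fin N → ℝ) => (p.1 + (ℓ : ℂ) * steps N p.2 (Fin.last N),
          fun j => if Int.fract (p.2 (Fin.rev j) / (2 * π)) < 1 / 2 then p.2 (Fin.rev j) + π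
            else p.2 (Fin.rev j) - π)) from
      funext fun p => (chainCurve_configReversal ℓ N p).symm,
    ← Measure.map_map hV hG, ← preimage_configReversal ℓ Ω x y N,
    ← Measure.restrict_map hG (measurableSet_admissibleConfigs ℓ Ω y x N),
    map_volume_configReversal]

/-- **The unnormalised critical measure is reversed by time reversal.** [folklore] -/
theorem weight_reverse (ℓ : ℝ) (Ω : Set ℂ) (x y : ℂ) :
    (weight ℓ Ω x y).map CurveClass.reverse = weight ℓ Ω y x := by
  rw [weight, weight, Measure.map_sum CurveClass.measurable_reverse.aemeasurable]
  congr 1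
  funext N
  rw [Measure.map_smul, weightTerm_reverse]

/-- **Exact reversibility of the critical freely-jointed chain**: at every step length, the law
of the chain from `B(y,ℓ)` to `B(x,ℓ)` in `Ω` is the time reversal of the law of the chain from
`B(x,ℓ)` to `B(y,ℓ)` — the off-lattice twin of the reversal symmetry `ω ↦ (ω_n, …, ω_0)` of
`μ_SAW` (LSW 2004, §3.1). [cite: LawlerSchrammWerner2004SAW, §3.1] -/
theorem law_reverse (ℓ : ℝ) (Ω : Set ℂ) (x y : ℂ) :
    law ℓ Ω y x = (law ℓ Ω x y).map CurveClass.reverse := by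
  rw [law, law, Measure.map_smul, weight_reverse, ← weight_reverse ℓ Ω x y,
    Measure.map_apply CurveClass.measurable_reverse MeasurableSet.univ, Set.preimage_univ]

end FreelyJointedSAW

end Literature.Probability.RandomPlanarGeometry
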